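import Literature.NumberTheory.Sieve.Maynard2016LadderDischarges
import Literature.NumberTheory.Sieve.Maynard2016Growth

/-!
# Ford–Green–Konyagin–Tao 2016, Theorem 2 (the covering bound `Y(x)`) holds

Trunk: AntSieve / parity (large-gaps ladder of `LargeGapsBetweenPrimes.lean`).

K. Ford, B. Green, S. Konyagin, T. Tao, *Large gaps between consecutive prime numbers*, Ann. of
Math. 183 (2016), Theorem 2: «For any `R > 0` and for sufficiently large `x`, we have
`Y(x) ≥ R x log x log₃ x/(log₂ x)²`», i.e. one residue class per prime `p ≤ x` covers `[1, y]` with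
`y ≥ R · x log x log₃ x/(log₂ x)²` (`FordGreenKonyaginTao2016_theorem2`, stated with
`ResidueClassesCover`).  The tree proves Maynard's covering statement of §2 for EVERY `C_U`
(`Maynard2016.CoveringTheorem_holds`: `[1, U]` covered, `U = C_U (1 − ε) x log x log₃ x/(log₂ x)²`,
`Maynard2016.U_eq`), which is the same bound read through Maynard 2016 instead of FGKT's own §§4–8;
this leaf performs the bookkeeping step (choose `C_U = 2(max R 0 + 1)`, any `ε < 1/2` in the
eventual range, and absorb the floor using `x log x log₃ x/(log₂ x)² ≥ 1` for large `x`,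
`Maynard2016.eventually_iteratedLogs`).  Theorems only; no statement, definition or attribute is
edited; no new named fact.

## References

* K. Ford, B. Green, S. Konyagin, T. Tao, Ann. of Math. (2) 183 (2016), 935–974, Theorem 2.
  [FordGreenKonyaginTao2016]
* J. Maynard, *Large gaps between primes*, Ann. of Math. (2) 183 (2016), §2. [Maynard2016LargeGaps]
-/

open Filter Topology

namespace Literature.NumberTheory.Sieve

/-- **Ford–Green–Konyagin–Tao 2016, Theorem 2** («for any `R > 0` and sufficiently large `x`,
`Y(x) ≥ R x log x log₃ x/(log₂ x)²`»), unconditionally, from Maynard's covering statement for every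
`C_U` (`Maynard2016.CoveringTheorem_holds`, `Maynard2016.U_eq`). [cite: FordGreenKonyaginTao2016, Theorem 2] -/
theorem FordGreenKonyaginTao2016_theorem2_holds :
    Literature.NumberTheory.Sieve.FordGreenKonyaginTao2016_theorem2 := by
  intro R
  have hC : (0 : ℝ) < 2 * (max R 0 + 1) := by positivity
  have hsmall : ∀ᶠ ε : ℝ in 𝓝[>] 0, ε < 1 / 2 :=
    eventually_nhdsWithin_of_eventually_nhds (eventually_lt_nhds (by norm_num))
  obtain ⟨ε, hcov, hε⟩ := ((Maynard2016.CoveringTheorem_holds _ hC).and hsmall).exists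
  filter_upwards [hcov, Maynard2016.eventually_iteratedLogs] with x hx hL
  obtain ⟨hL1, hL2, hL3, -, hL2L, -, hsq⟩ := hL
  refine ⟨⌊Maynard2016.U (2 * (max R 0 + 1)) ε x⌋₊, ?_, hx⟩
  rw [Maynard2016.U_eq]
  have e3 : Real.log^[3] (x : ℝ) = Real.log (Real.log (Real.log x)) := rfl
  have e2 : Real.log^[2] (x : ℝ) = Real.log (Real.log x) := rfl
  rw [e3, e2]
  set r : ℝ := (x : ℝ) * Real.log x * Real.log (Real.log (Real.log x)) /
    (Real.log (Real.log x)) ^ 2 with hr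
  have hL2pos : 0 < Real.log (Real.log (x : ℝ)) := by linarith
  have hr1 : 1 ≤ r := by
    rw [hr, le_div_iff₀ (by positivity)]
    have h1 : (Real.log (Real.log (x : ℝ))) ^ 2 ≤ (Real.log (x : ℝ)) ^ 2 := by
      nlinarith
    have hx1 : (Real.log (Real.log (x : ℝ))) ^ 2 ≤ (x : ℝ) := h1.trans hsq
    have h2 : (x : ℝ) ≤ (x : ℝ) * Real.log x * Real.log (Real.log (Real.log x)) := by
      have hx0 : (0 : ℝ) ≤ x := by positivity
      nlinarith [mul_nonneg hx0 (show (0:ℝ) ≤ Real.log x - 1 by linarith)]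
    linarith
  have hCR : R + 1 ≤ 2 * (max R 0 + 1) * (1 - ε) := by
    nlinarith [le_max_left R 0, le_max_right R 0]
  calc R * r ≤ 2 * (max R 0 + 1) * (1 - ε) * r - 1 := by nlinarith
    _ ≤ (⌊2 * (max R 0 + 1) * (1 - ε) * r⌋₊ : ℝ) := (Nat.sub_one_lt_floor _).le

end Literature.NumberTheory.Sieve
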